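import Summits.HodgeConjecture.HodgeConjecture.Theorems.H413CohFormsCarriers
import Summits.HodgeConjecture.HodgeCM.Model.BallInstance
import Literature.NumberTheory.Automorphic.UnitaryGroupArchSection
import HarnessLib

/-!
# FLOOR-0 programme P4, stub T1 CLOSED: the archimedean factorisation of `U(V)(𝔸_{F⁺})` exists (`ArchFactor.IsHonest`)

Cell hodgecm-mathlib (D-0151), FLOOR 0 (D-0183); crux item H413 = stmt-HodgeConjecture-24833; line `Cruxes/H413/Lines/P4AdmissibleOccursInH1.lean`
(A-p13 (g21)), stub `stub_T1_archFactor : StubT1ArchFactor := ∀ F [IsGalois ℚ F] (6 ≤ [F:ℚ]) {ι₁} V, ∃ 𝔞 : ArchFactor F V, 𝔞.IsHonest`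
(shared with P2's `stub_U0`).  THIS FILE PROVES IT — THEOREMS ONLY (no `def`), no hole, no named fact — for THE FACTOR OF RECORD `archFactorOf F V` of the carriers' §3
(`archFactorOf_isHonest`; v2 of the P4 line states T2/T3 at this factor), by assembling tree constructions:

* `ιinf := UnitaryGroup.archSectionU21Emb F⁺ K c̄ … ι₁ … (Hm V) T …` (★ `Automorphic/UnitaryGroupArchSection` §2: the archimedean SECTION
  `U(2,1) ≅ U((Hm V) ⊗_{ι₁} ℂ) ↪ U(Hm V)(K ⊗ ℝ) ↪ U(Hm V)(𝔸_{F⁺})` through the Sylvester frame `T = V.sylvesterFrame` of HodgeCM's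
  `Model/BallInstance` (`sylvesterFrame_J : Tᴴ · ι₁(Hm V) · T = diag(1,1,-1)`)); injective (★ `archSectionU21Emb_injective`);
* `Kc := (ker archProjU21EmbCM).map archToAdelic` — the archimedean elements with trivial `ι₁`-component, `≅ Π_{w ≠ ι₁} U(σ_w Hm V)(ℂ)`; COMPACT
  because `Hm V` is positive definite at every place `≠ ι₁` (`HermSpace3.posDef_of_ne`, ★ `isCompact_ker_archProjU21EmbCM_of_posDef`
  [PlatonovRapinchuk1994, §3.2 Thm 3.1], ★ `continuous_archToAdelic`);
* commutations: ★ `commute_archSectionU21Emb_of_mem_awayFrom` (with `Kc`, and with the finite-adelic points via ★ `finAdelicToAdelic_mem_awayFrom`),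
  ★ `commute_archToAdelic_finAdelicToAdelic`;
* product decomposition `x = ιinf u · k · (1, g)`: ★ `archToAdelic_mul_finAdelicToAdelic` (`g = (g_∞,1)(1,g_f)`), and `g_∞ = archSingle_{ι₁}((g_∞)_{ι₁}) · a′`
  with `a′ ∈ ker`, where `archSingle_{ι₁}((g_∞)_{ι₁}) = ιinf (archProjU21Emb g_∞)` (★ `archLocalOfEmb_archAtEmb`, `archAt_archSingle_self`);
* `range ιinf ⊔ Kc = range archToAdelic` from the same decomposition (`Subgroup.mul_mem_sup`).

`exists_archFactor_isHonest F V` is the existence statement at one face; `stubT1ArchFactor_holds` its ∀-closure = the stub's body.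
So `stub_T1_archFactor := P4StubT1ArchFactor.stubT1ArchFactor_holds` closes the P4 line's first hole BY NAME (and P2's `stub_U0`).  HC_CM is proved only modulo the
7 printed citations until rung 0 closes; this file discharges no citation — it is the S-sized first stub of one FLOOR-0 programme.

## References
* [BorelJacquet1979] A. Borel, H. Jacquet, Corvallis PSPM 33.1, §4.1 (`G(𝔸) = G_∞ × G(𝔸_f)`, `G_∞ = ∏_v G(F_v)`).
* [PlatonovRapinchuk1994] V. Platonov, A. Rapinchuk, §2.3, §3.2 Thm. 3.1, §5.1.
* Tree: ★ `Automorphic/UnitaryGroupArchSection`, `UnitaryGroupArchProjectionEmb`, `UnitaryGroupArchimedeanPlaces`, `UnitaryGroupArchimedean`,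
  `UnitaryGroupAdelicProduct`; HodgeCM `Model/BallInstance` (`sylvesterFrame_J`); `Theorems/H413CohFormsCarriers` (`ArchFactor`, `IsHonest`; namespace `…Cruxes.H413.CohFormsCarriers`).
-/

set_option autoImplicit false
set_option linter.dupNamespace false

noncomputable section

namespace Summit.HodgeConjecture.HodgeConjecture.Cruxes.H413.P4StubT1ArchFactor

open NumberField NumberField.InfinitePlace
open Literature.NumberTheory.Automorphic Literature.NumberTheory.Automorphic.UnitaryGroup
open Literature.Geometry.ComplexHyperbolic.BallModel (U21)
open Summit.HodgeConjecture.HodgeConjecture.Cruxes.H413.CohFormsCarriers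

set_option maxHeartbeats 400000 in
/-- **The archimedean factor of record `archFactorOf F V` IS HONEST** — all seven clauses of the carriers' predicate
`ArchFactor.IsHonest` for `⟨archSectionU21CM … V.sylvesterFrame …, (ker archProjU21EmbCM).map archToAdelic⟩`: `ιinf` injective; `K_c` compact;
`ιinf`, `K_c`, `U(V)(𝔸_{F⁺,f})` pairwise commute; every adelic point is `ιinf u · k · (1, g)`; `range ιinf ⊔ K_c = U(V)(F⁺ ⊗ ℝ) × 1`.
[cite: BorelJacquet1979, §4.1] [cite: PlatonovRapinchuk1994, §3.2 Thm 3.1; §5.1] -/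
theorem archFactorOf_isHonest (F : HodgeCM.CMField) {ι₁ : F →+* ℂ} (V : HodgeCM.HermSpace3 F ι₁) :
    (archFactorOf F V).IsHonest := by
  -- notation
  set K := HodgeCM.CMField.K F with hK
  let Fp : Type := ↥(maximalRealSubfield K)
  let c := IsCMField.complexConj K
  have hc : c ≠ 1 := IsCMField.complexConj_ne_one K
  have hfix : ∀ w : InfinitePlace K, c • w = w := UnitaryGroup.complexConj_smul_infinitePlace K
  let J : Matrix (Fin 3) (Fin 3) K := HodgeCM.HermSpace3.Hm V
  have hι : IsComplex (InfinitePlace.mk ι₁) := isComplex_mk_of_isCMField K ι₁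
  let T : GL (Fin 3) ℂ := V.sylvesterFrame
  have hT : formCongr (starRingEnd ℂ) T (J.map ι₁) = Literature.Geometry.ComplexHyperbolic.BallModel.J :=
    formCongr_eq_of_conjTranspose K ι₁ J T (HodgeCM.Model.sylvesterFrame_J V)
  let w₁ : {w : InfinitePlace K // IsComplex w} := placeOf K ι₁ hι
  -- the pieces
  let ιinf : ↥U21 →* (adelicGroupData Fp K c 3 J).Adelic := archSectionU21Emb Fp K c hc hfix ι₁ hι J T hT
  let proj : arch Fp K c 3 J →* ↥U21 := archProjU21Emb Fp K c J ι₁ hι T hT (hfix _) hc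
  let toA : arch Fp K c 3 J →* (adelicGroupData Fp K c 3 J).Adelic := archToAdelic Fp K c 3 J
  let toF : finAdelic Fp K c 3 J →* (adelicGroupData Fp K c 3 J).Adelic := finAdelicToAdelic Fp K c 3 J
  let 𝔞 : ArchFactor F V := archFactorOf F V
  have hιinf : 𝔞.ιinf = ιinf := rfl
  have hKc : 𝔞.Kc = proj.ker.map toA := rfl
  -- (a) `ιinf (proj a) = archToAdelic (archSingle w₁ (archAt w₁ a))`
  have key : ∀ a : arch Fp K c 3 J,
      ιinf (proj a) = toA (archSingle Fp K c 3 J hc hfix w₁ (archAt Fp K c 3 J w₁ (hfix w₁.1) hc a)) := by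
    intro a
    show archSectionU21Emb Fp K c hc hfix ι₁ hι J T hT (archProjU21Emb Fp K c J ι₁ hι T hT (hfix _) hc a) = _
    rw [archSectionU21Emb_apply, adelicSingle_apply]
    congr 2
    show archLocalOfEmb K 3 J ι₁ hι ((formEquivU21 K J ι₁ T hT).symm
      ((formEquivU21 K J ι₁ T hT) (archAtEmb Fp K c 3 J ι₁ hι (hfix _) hc a))) = _
    rw [ContinuousMulEquiv.symm_apply_apply, archLocalOfEmb_archAtEmb]
  -- (b) membership in `Kc`: `toA a ∈ Kc ↔ archAt w₁ a = 1`
  have memKc : ∀ {k : (adelicGroupData Fp K c 3 J).Adelic}, k ∈ proj.ker.map toA →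
      ∃ a : arch Fp K c 3 J, archAt Fp K c 3 J w₁ (hfix w₁.1) hc a = 1 ∧ toA a = k := by
    intro k hk
    obtain ⟨a, ha, rfl⟩ := Subgroup.mem_map.1 hk
    refine ⟨a, ?_, rfl⟩
    have ha' : a ∈ (archAt Fp K c 3 J w₁ (hfix w₁.1) hc).ker := by
      rw [← ker_archProjU21Emb Fp K c J ι₁ hι T hT (hfix _) hc]; exact ha
    exact MonoidHom.mem_ker.1 ha'
  have mkKc : ∀ {a : arch Fp K c 3 J}, archAt Fp K c 3 J w₁ (hfix w₁.1) hc a = 1 → toA a ∈ proj.ker.map toA := by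
    intro a ha
    refine Subgroup.mem_map.2 ⟨a, ?_, rfl⟩
    rw [ker_archProjU21Emb Fp K c J ι₁ hι T hT (hfix _) hc]
    exact MonoidHom.mem_ker.2 ha
  -- (c) the decomposition of an archimedean element: `toA a = ιinf (proj a) * toA a'` with `toA a' ∈ Kc`
  have decomp : ∀ a : arch Fp K c 3 J, ∃ a' : arch Fp K c 3 J,
      archAt Fp K c 3 J w₁ (hfix w₁.1) hc a' = 1 ∧ toA a = ιinf (proj a) * toA a' := by
    intro a
    refine ⟨(archSingle Fp K c 3 J hc hfix w₁ (archAt Fp K c 3 J w₁ (hfix w₁.1) hc a))⁻¹ * a, ?_, ?_⟩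
    · rw [map_mul, map_inv, archAt_archSingle_self, inv_mul_cancel]
    · rw [key a, ← map_mul, mul_inv_cancel_left]
  show 𝔞.IsHonest
  refine ⟨?_, ?_, ?_, ?_, ?_, ?_, ?_⟩
  -- (1) injective
  · rw [hιinf]; exact archSectionU21Emb_injective Fp K c hc hfix ι₁ hι J T hT
  -- (2) compact
  · rw [hKc, Subgroup.coe_map]
    exact (isCompact_ker_archProjU21EmbCM_of_posDef K J ι₁ T hT V.posDef_of_ne).image
      (continuous_archToAdelic Fp K c 3 J)
  -- (3) ιinf commutes with Kc
  · intro u k hk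
    rw [hKc] at hk
    obtain ⟨a, ha, rfl⟩ := memKc hk
    have hmem : toA a ∈ awayFrom Fp K c 3 J hc hfix w₁ := (archToAdelic_mem_awayFrom_iff Fp K c 3 J hc hfix w₁ a).2 ha
    exact (commute_archSectionU21Emb_of_mem_awayFrom Fp K c hc hfix ι₁ hι J T hT u hmem).eq.symm
  -- (4) ιinf commutes with the finite-adelic points
  · intro u g
    exact (commute_archSectionU21Emb_of_mem_awayFrom Fp K c hc hfix ι₁ hι J T hT u
      (finAdelicToAdelic_mem_awayFrom Fp K c 3 J hc hfix w₁ g)).eq.symm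
  -- (5) Kc commutes with the finite-adelic points
  · intro k hk g
    rw [hKc] at hk
    obtain ⟨a, -, rfl⟩ := memKc hk
    exact (commute_archToAdelic_finAdelicToAdelic Fp K c 3 J a g).eq
  -- (6) product decomposition
  · intro x
    obtain ⟨a', ha', hdec⟩ := decomp (archPart Fp K c 3 J x)
    refine ⟨proj (archPart Fp K c 3 J x), toA a', finPart Fp K c 3 J x, ?_, ?_⟩
    · rw [hKc]; exact mkKc ha'
    · rw [hιinf, ← hdec]
      exact (archToAdelic_mul_finAdelicToAdelic Fp K c 3 J x).symm
  -- (7) range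
  · apply le_antisymm
    · refine sup_le ?_ ?_
      · rintro _ ⟨u, rfl⟩
        rw [hιinf]
        show archSectionU21Emb Fp K c hc hfix ι₁ hι J T hT u ∈ _
        rw [archSectionU21Emb_apply, adelicSingle_apply]
        exact ⟨_, rfl⟩
      · rw [hKc]; exact Subgroup.map_le_range _ _
    · rintro _ ⟨a, rfl⟩
      obtain ⟨a', ha', hdec⟩ := decomp a
      rw [show archToAdelic' F V a = toA a from rfl, hdec]
      exact Subgroup.mul_mem_sup ⟨proj a, by rw [hιinf]⟩ (by rw [hKc]; exact mkKc ha')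

/-- **An honest archimedean factor EXISTS at every face** (`𝔞₀ = archFactorOf F V`). [cite: BorelJacquet1979, §4.1] -/
theorem exists_archFactor_isHonest (F : HodgeCM.CMField) {ι₁ : F →+* ℂ} (V : HodgeCM.HermSpace3 F ι₁) :
    ∃ 𝔞 : ArchFactor F V, 𝔞.IsHonest :=
  ⟨archFactorOf F V, archFactorOf_isHonest F V⟩

/-- **P4 v1's STUB T1 `StubT1ArchFactor`, closed by name** (the `∀`-face closure; binder-for-binder the body of
`…Cruxes.H413.P4AdmissibleOccursInH1.StubT1ArchFactor`, so `stub_T1_archFactor := stubT1ArchFactor_holds`). [cite: BorelJacquet1979, §4.1]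
[cite: PlatonovRapinchuk1994, §5.1] -/
theorem stubT1ArchFactor_holds :
    ∀ (F : HodgeCM.CMField) [IsGalois ℚ F] (_h6 : 6 ≤ Module.finrank ℚ F) {ι₁ : F →+* ℂ} (V : HodgeCM.HermSpace3 F ι₁),
      ∃ 𝔞 : ArchFactor F V, 𝔞.IsHonest :=
  fun F _ _ _ V => exists_archFactor_isHonest F V

end Summit.HodgeConjecture.HodgeConjecture.Cruxes.H413.P4StubT1ArchFactor

end
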